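import Summits.BirchSwinnertonDyer.BirchSwinnertonDyer.Theorems.SylvesterTwoHeegnerIndexCMFlipReductionDatum
import Summits.BirchSwinnertonDyer.BirchSwinnertonDyer.Theorems.SylvesterTwoHeegnerIndexCMFlipLevelPrimePrep
import Summits.BirchSwinnertonDyer.BirchSwinnertonDyer.Theorems.SylvesterTwoHeegnerIndexCMFlipLevelPairPrep
import Summits.BirchSwinnertonDyer.BirchSwinnertonDyer.Theorems.SylvesterTwoHeegnerIndexCMDataPairRecipe
import Summits.BirchSwinnertonDyer.BirchSwinnertonDyer.Theorems.SylvesterTwoHeegnerIndexCMDataCoupledFrame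
import Summits.BirchSwinnertonDyer.Rank1Residual.X11b.KolyvaginH44OfEulerCongruence
import Literature.NumberTheory.EllipticCurves.KolyvaginClassFlipSupersingular
import Literature.NumberTheory.EllipticCurves.KolyvaginClassLocalConditionCoprimeIndex
import Literature.NumberTheory.EllipticCurves.HuShuYin2019.SylvesterPairGoodPlaces
import HarnessLib

/-!
# (F) of leaf (L1), crux `UpperOffV0HSYPlus` (stmt-BirchSwinnertonDyer-19804): THE AT-LEVEL FLIP at the
# two-prime level `9pℓℓ'` for the HSY pair, block 2 of (L1) — «`c_B(ℓℓ')` Selmer at `λ ∋ ℓ` ↔ `c_A(ℓ') ∈ T_A(λ)`» —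
# k-ty1 #14 INSTANTIATED in its native orientation `(W₁, W₂) = (B_K, A_K)`, modulo displayed inputs

Skeleton of record VARIANT M (`Cruxes/UpperOffV0HSYPlus/Lines/coupled_variantM.lean` 406ca288e244d392);
card v28; planner D472/D475/D476/D486.  Sibling of `…CMFlipLevelPrime` (block 1).  ONE main theorem,
`flip_levelPair`: the third conjunct of #24 `L1_of_cmFrameClasses_four`'s SECOND block for the class terms built
from the coupled frame (#R-g) at the level `9pℓℓ'` — `P_{ℓℓ'} = κ⁻¹ ι(D_ℓ D_{ℓ'} y_{ℓℓ'})` (#R-f's shape, outer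
derivative at the FLIP prime `ℓ`), `P_{ℓ'} = κ⁻¹ ι(D_{ℓ'} y_{ℓ'})` read at the same level — by ONE CALL of #14.

AUDIT TRAIL (#14 binder ↦ source): frame `hψ₁ hψ₂ hρcomm` #R-g binders · `hρ'` `rfl` (`ρ' = ρ ∘ ρ`) · `N.Normal`,
`hcomm` as in block 1 · `hPnN` #R-c `map_emb_mem_fixedPoints` · `hA₁ hA₂ hP₁ hP₂` binders · `hgood`, `hpv`, `𝔐`,
`hsurj` as in block 1 · `F hF hFfix` `exists_isArithFrobAt_mem_torsionFixing` for `A` from the stub's Kolyvagin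
clauses for `A` · `hFv₂ hIv₁` `inertia_package` + #R-c (`N'` fixes `v_A`, `v_B`) · `red … hχ` #F0
`exists_frame_reductionDatum` (`v := v_B`, family `ρ`) · `τ₀ hτ₀ hIτ₀` `inertia_package` · THE ROOT
`R = l' • κ⁻¹ ι(D_{ℓ'} y_{ℓℓ'})`: `pointGalHom_derivOp_sub_eq_of_trace_eq_zero` with `z = D_{ℓ'} y`, its trace
hypothesis from `pointGalHom_derivOp_comm` (`σ_ℓ`, `σ_{ℓ'}` commute in the abelian `Gal(K[9pℓℓ']/K)`, x11b3
`isMulCommutative_ringClassGal'`) + (ES1) at the pair level (#R-e1 `sum_pointGalHom_eq_lFunction_smul_sylvester_pair_left`,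
range form via `sum_range_pow_eq_sum_image`) + `a_ℓ(E₉) = 0`; `hR` by `smul_embPoints_sub_eq_zsmul` · `hRred`
THE DISPLAYED (ES2) (γ-wise, through `map_smul_derivOp_eq_of_forall`) · `hFP₂` from the displayed `hPmFrob`
(`Frob_𝔓` fixes `P_{ℓ'}`: in #H from #17b §4 at the level `9pℓ'`) + `JZero.smul_chiComponent_eq_self` +
`JZero.rho_apply_of_apply_eq` · `hsel₂` DISPLAYED (in #H: k-ty1 #11 at the level `9pℓ'` + #R-h `kolyvaginClass_mono`).

HONEST FRAMING: theorems only (no definition, no named fact, no instance, no notation); the displayed hypotheses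
are `hES` (the γ-wise reading of `Nekovar2007.cmPoint_frobeniusCongruence` on HSY's tower, k-ty1 #20
`geomReduction_sylvesterTower_eq_frob_smul`, written at the level `9 * p * (ℓ * ℓ')`), `hPmFrob`, `hsel₂`, `hP₁`,
`hP₂`, `hA₁`, `hA₂` — all instantiated in #H; nothing asserted; nothing about Ш/BSD; no stub closed; X12.CMAtTwo
NOT proved; `--supports stmt-BirchSwinnertonDyer-19804 --as helper`.  References: [GrossLMS1991] §3 (3.5), Prop. 3.6,
3.7, §4, Prop. 6.2; [McCallumLMS1991] §4, Prop. 4.4; [Nekovar2007] Prop. 4.9, 4.13 (ii); [HuShuYin2019] §1–§2, §4.1.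
Tree search: `lean search 'flip_levelPair'` → nothing before this file; presearch n/a (assembly).
`set_option maxHeartbeats 1600000 in` is scoped to the one theorem: the #14 call unifies ~45 binders (D489 (1)).
-/

set_option linter.dupNamespace false -- Summits modules are `Summit.<Summit>.<Problem>…` by design
set_option autoImplicit false

noncomputable section

open scoped Classical Pointwise

namespace Summit.BirchSwinnertonDyer.BirchSwinnertonDyer.Theorems.SylvesterTwoCMFlip

open WeierstrassCurve Field NumberField IsDedekindDomain Finset
open Literature.NumberTheory.EllipticCurves Literature.NumberTheory.GaloisRepresentations
  Literature.NumberTheory.EllipticCurves.ModularForms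
  Literature.NumberTheory.EllipticCurves.HuShuYin2019
  Literature.NumberTheory.EllipticCurves.KolyvaginCocycle
  Summit.BirchSwinnertonDyer.BirchSwinnertonDyer.Theorems.SylvesterTwoCMData
  Summit.BirchSwinnertonDyer.Rank1Residual.X11b
  Summit.BirchSwinnertonDyer.Rank1Residual.X11b.RingClassTower

variable {K : Type} [Field K] [NumberField K]
set_option maxHeartbeats 1600000 in
/-- **THE FLIP at level `9pℓℓ'`, block 2 of leaf (L1)** — k-ty1 #14 INSTANTIATED for the HSY pair
`(B, A) = (E_p, E_{3p²})` over `K ∋ ω` in the orientation `(W₁, W₂) = (B_K, A_K)`, at Kolyvagin primes `ℓ ≠ ℓ'`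
(`≡ 2 (3)`) of the pair at `2` and the place `λ ∋ ℓ`: for the coupled frame (#R-g), an embedded `K[9pℓℓ']`
(`emb`, `N`, the `K[9p]`-fixer `N'`, representatives `t`), generators `σ_ℓ` of `Gal(K[9pℓℓ']/K[9pℓ'])` and
`σ_{ℓ'}` of `Gal(K[9pℓℓ']/K[9pℓ])`, HSY's CM points `y_{ℓℓ'}`, `y_{ℓ'}` of conductors `9pℓℓ'`, `9pℓ'` on the minimal
model `W₀` read in `K[9pℓℓ']`, the derived points `P_{ℓℓ'} = κ⁻¹ ι(D_ℓ D_{ℓ'} y_{ℓℓ'})`, `P_{ℓ'} = κ⁻¹ ι(D_{ℓ'} y_{ℓ'})`: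
**`c(ψ_B (P_{ℓℓ'}^{χ_B}))` is Selmer at `λ` iff `c(ψ_A (P_{ℓ'}^{χ_A})) ∈ T_A(λ)`**, GRANTED the displayed inputs —
the γ-wise reduction congruence (ES2) `red(g y_{ℓℓ'}^γ) = Frob_ℓ red(g y_{ℓ'}^γ)` (Nekovář 2007 Prop. 4.9 on HSY's
tower, k-ty1 #20, hypothesis `hES`), «every arithmetic Frobenius above `λ` fixes `P_{ℓ'}`» (`hPmFrob`), and the
Selmer condition of the lower class at `λ` (`hsel₂`).  [cite: GrossLMS1991, §3 (3.5), Prop. 3.7, Prop. 6.2, §4]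
[cite: McCallumLMS1991, Prop. 4.4, §4 (4)–(6)] [cite: HuShuYin2019, §1 p. 4, §2 Prop. 2.4, §4.1]
[cite: Nekovar2007, Prop. 4.9, Prop. 4.13 (ii)] -/
theorem flip_levelPair {ω : K} (hω : ω ^ 2 + ω + 1 = 0) (h2 : Module.finrank ℚ K = 2)
    (ι : K →+* ℂ) [(⟨0, 0, 1, 0, -1⟩ : WeierstrassCurve ℚ).IsElliptic] [(⟨0, 0, 1, 0, -1⟩ : WeierstrassCurve ℚ).IsGloballyMinimal] (Dt : ModularParametrizationData (⟨0, 0, 1, 0, -1⟩ : WeierstrassCurve ℚ) 243)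
    {p ℓ ℓ' : ℕ} (hp : p.Prime) (hp3 : p % 3 = 1) [Fact ℓ.Prime] (hℓ3 : ℓ % 3 = 2) (hℓ2 : ℓ ≠ 2)
    (hℓp : ¬ ℓ ∣ p) (hℓ' : ℓ'.Prime) (hℓ'3 : ℓ' % 3 = 2) (hne : ℓ ≠ ℓ') (hℓ'p : ¬ ℓ' ∣ p)
    (hℓA : ¬ ℓ ∣ (cubeSumCurve (3 * (p : ℚ) ^ 2)).conductorNorm ℤ)
    (hℓdK : ¬ ((ℓ : ℤ) ∣ NumberField.discr K))
    (hFrobA : FrobEqFrobInfty (cubeSumCurve (3 * (p : ℚ) ^ 2)) K 2 ℓ)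
    (hΔ : ¬ (ℓ : ℤ) ∣ minimalDiscriminantInt (⟨0, 0, 1, 0, -1⟩ : WeierstrassCurve ℚ))
    -- the frame transport `E₉(K̄) ≃+ W₀(K̄)`
    (κ : geomPoints ((cubeSumCurve 9).baseChange K) ≃+ geomPoints ((⟨0, 0, 1, 0, -1⟩ : WeierstrassCurve ℚ).baseChange K))
    (hκG : ∀ (g : absoluteGaloisGroup K) (P : geomPoints ((cubeSumCurve 9).baseChange K)), κ (g • P) = g • κ P)
    {a b d : AlgebraicClosure K}
    (hκ : ∀ {x y : AlgebraicClosure K}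
      (h : (((cubeSumCurve 9).baseChange K).baseChange (AlgebraicClosure K)).toAffine.Nonsingular x y),
      ∃ h', κ (.some x y h) = .some (a * x) (b * y + d) h')
    -- the coupled frame (#R-g `exists_coupledFrame`)
    {vB vA : AlgebraicClosure K} (hvBc : vB ^ 3 = algebraMap ℚ (AlgebraicClosure K) ((p : ℚ) / 9))
    (hvB : vB ≠ 0) (hvAc : vA ^ 3 = algebraMap ℚ (AlgebraicClosure K) ((p : ℚ) ^ 2 / 3)) (hvA0 : vA ≠ 0)
    (hvB3 : ∀ g : absoluteGaloisGroup K, ((show AlgebraicClosure K ≃ₐ[K] AlgebraicClosure K from g) vB) ^ 3 = vB ^ 3)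
    (hvA3 : ∀ g : absoluteGaloisGroup K, ((show AlgebraicClosure K ≃ₐ[K] AlgebraicClosure K from g) vA) ^ 3 = vA ^ 3)
    {ψB : geomPoints ((cubeSumCurve 9).baseChange K) ≃+ geomPoints ((cubeSumCurve (p : ℚ)).baseChange K)}
    {ψA : geomPoints ((cubeSumCurve 9).baseChange K) ≃+ geomPoints ((cubeSumCurve (3 * (p : ℚ) ^ 2)).baseChange K)}
    (hψB : ∀ {x y : AlgebraicClosure K}
      (h : (((cubeSumCurve 9).baseChange K).baseChange (AlgebraicClosure K)).toAffine.Nonsingular x y),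
      ∃ h', ψB (Affine.Point.some x y h) = Affine.Point.some (vB ^ 2 * x) (vB ^ 3 * y) h')
    (hψA : ∀ {x y : AlgebraicClosure K}
      (h : (((cubeSumCurve 9).baseChange K).baseChange (AlgebraicClosure K)).toAffine.Nonsingular x y),
      ∃ h', ψA (Affine.Point.some x y h) = Affine.Point.some (vA ^ 2 * x) (vA ^ 3 * y) h')
    {ρ : absoluteGaloisGroup K → geomPoints ((cubeSumCurve 9).baseChange K) ≃+ geomPoints ((cubeSumCurve 9).baseChange K)}
    (hρ : ∀ (g : absoluteGaloisGroup K) {x y : AlgebraicClosure K}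
        (h : (((cubeSumCurve 9).baseChange K).baseChange (AlgebraicClosure K)).toAffine.Nonsingular x y),
        ∃ h', ρ g (Affine.Point.some x y h) =
          Affine.Point.some (((show AlgebraicClosure K ≃ₐ[K] AlgebraicClosure K from g) vB / vB) ^ 2 * x) y h')
    (hρρ : ∀ (g : absoluteGaloisGroup K) {x y : AlgebraicClosure K}
        (h : (((cubeSumCurve 9).baseChange K).baseChange (AlgebraicClosure K)).toAffine.Nonsingular x y),
        ∃ h', ρ g (ρ g (Affine.Point.some x y h)) =
          Affine.Point.some (((show AlgebraicClosure K ≃ₐ[K] AlgebraicClosure K from g) vA / vA) ^ 2 * x) y h')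
    (hlawB : ∀ (g : absoluteGaloisGroup K) (P : geomPoints ((cubeSumCurve 9).baseChange K)),
        g • ψB P = ψB (ρ g (g • P)))
    (hlawA : ∀ (g : absoluteGaloisGroup K) (P : geomPoints ((cubeSumCurve 9).baseChange K)),
        g • ψA P = ψA (ρ g (ρ g (g • P))))
    (hρcomm : ∀ (g h : absoluteGaloisGroup K) (P : geomPoints ((cubeSumCurve 9).baseChange K)),
        h • ρ g P = ρ g (h • P))
    -- the level `K[9pℓℓ']`: embedding, fixer, the `K[9p]`-fixer, representatives
    (emb : ringClassField K ι (9 * p * (ℓ * ℓ')) →+* AlgebraicClosure K)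
    (hemb : ∀ k : K, emb (algebraMap K (ringClassField K ι (9 * p * (ℓ * ℓ'))) k) = algebraMap K (AlgebraicClosure K) k)
    (ιe : letI : DecidableEq (ringClassField K ι (9 * p * (ℓ * ℓ'))) := fun a b ↦ Classical.propDecidable (a = b)
      ((⟨0, 0, 1, 0, -1⟩ : WeierstrassCurve ℚ).baseChange (ringClassField K ι (9 * p * (ℓ * ℓ')))).toAffine.Point →+ geomPoints ((⟨0, 0, 1, 0, -1⟩ : WeierstrassCurve ℚ).baseChange K))
    (hιe : ∀ P, ιe P = Affine.Point.map (W' := (⟨0, 0, 1, 0, -1⟩ : WeierstrassCurve ℚ)) emb.toRatAlgHom P)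
    (N : Subgroup (absoluteGaloisGroup K))
    (hN : ∀ g : absoluteGaloisGroup K, g ∈ N ↔
      ∀ x : ringClassField K ι (9 * p * (ℓ * ℓ')), (show AlgebraicClosure K ≃ₐ[K] AlgebraicClosure K from g) (emb x) = emb x)
    (N' : Subgroup (absoluteGaloisGroup K))
    (hN' : ∀ g : absoluteGaloisGroup K, g ∈ N' ↔
      ∀ x ∈ {x : ringClassField K ι (9 * p * (ℓ * ℓ')) | (x : ℂ) ∈ ringClassField K ι (9 * p)},
        (show AlgebraicClosure K ≃ₐ[K] AlgebraicClosure K from g) (emb x) = emb x)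
    {ιt : Type} [Fintype ιt] (t : ιt → absoluteGaloisGroup K)
    -- generators and HSY's CM points of conductors `9pℓℓ'`, `9pℓ'` read in `K[9pℓℓ']` (#R-f's shapes)
    {σ σ' : ringClassField K ι (9 * p * (ℓ * ℓ')) ≃ₐ[ℚ] ringClassField K ι (9 * p * (ℓ * ℓ'))}
    (hσ : Subgroup.zpowers σ = ringClassGalOver ι (9 * p * (ℓ * ℓ')) (9 * p * ℓ'))
    (hσ' : Subgroup.zpowers σ' = ringClassGalOver ι (9 * p * (ℓ * ℓ')) (9 * p * ℓ))
    {y yℓ' : ((⟨0, 0, 1, 0, -1⟩ : WeierstrassCurve ℚ).baseChange (ringClassField K ι (9 * p * (ℓ * ℓ')))).toAffine.Point}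
    (hy : Affine.Point.map (W' := (⟨0, 0, 1, 0, -1⟩ : WeierstrassCurve ℚ)) (ringClassField K ι (9 * p * (ℓ * ℓ'))).subtype.toRatAlgHom y =
      Dt.φ (heegnerTau (((ℓ * ℓ' : ℕ) : ℤ) ^ 2 * (81 * ((p : ℤ) ^ 2 + 4 * p + 16)),
        ((ℓ * ℓ' : ℕ) : ℤ) * (-(9 * (4 * (p : ℤ) ^ 2 + 17 * p + 72))), 4 * (p : ℤ) ^ 2 + 18 * p + 81)))
    (hyℓ' : Affine.Point.map (W' := (⟨0, 0, 1, 0, -1⟩ : WeierstrassCurve ℚ)) (ringClassField K ι (9 * p * (ℓ * ℓ'))).subtype.toRatAlgHom yℓ' =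
      Dt.φ (heegnerTau ((ℓ' : ℤ) ^ 2 * (81 * ((p : ℤ) ^ 2 + 4 * p + 16)),
        (ℓ' : ℤ) * (-(9 * (4 * (p : ℤ) ^ 2 + 17 * p + 72))), 4 * (p : ℤ) ^ 2 + 18 * p + 81)))
    -- the classes' admissibility / invariance inputs (#R-g `coupledFrame_levelPackage`, #R-h, #R-c at `9pℓ'`)
    {hdivA : ∀ P : geomPoints ((cubeSumCurve (3 * (p : ℚ) ^ 2)).baseChange K),
      ∃ R : geomPoints ((cubeSumCurve (3 * (p : ℚ) ^ 2)).baseChange K), ((2 : ℕ) : ℤ) • R = P}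
    {hdivB : ∀ P : geomPoints ((cubeSumCurve (p : ℚ)).baseChange K),
      ∃ R : geomPoints ((cubeSumCurve (p : ℚ)).baseChange K), ((2 : ℕ) : ℤ) • R = P}
    (hA₁ : IsAdmissible (absoluteGaloisGroup K)
      ((FixedPoints.addSubgroup N (geomPoints ((cubeSumCurve 9).baseChange K))).map ψB.toAddMonoidHom) ((2 : ℕ) : ℤ))
    (hA₂ : IsAdmissible (absoluteGaloisGroup K)
      ((FixedPoints.addSubgroup N (geomPoints ((cubeSumCurve 9).baseChange K))).map ψA.toAddMonoidHom) ((2 : ℕ) : ℤ))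
    (hP₁ : ψB (∑ i, ρ (t i) (t i • κ.symm (ιe (KolyvaginOperator.derivOp (pointGalHom (⟨0, 0, 1, 0, -1⟩ : WeierstrassCurve ℚ) (ringClassField K ι (9 * p * (ℓ * ℓ')))) σ ℓ
          (KolyvaginOperator.derivOp (pointGalHom (⟨0, 0, 1, 0, -1⟩ : WeierstrassCurve ℚ) (ringClassField K ι (9 * p * (ℓ * ℓ')))) σ' ℓ' y))))) ∈
      invPoints (absoluteGaloisGroup K)
        ((FixedPoints.addSubgroup N (geomPoints ((cubeSumCurve 9).baseChange K))).map ψB.toAddMonoidHom) ((2 : ℕ) : ℤ))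
    (hP₂ : ψA (∑ i, ρ (t i) (ρ (t i) (t i • κ.symm (ιe (KolyvaginOperator.derivOp (pointGalHom (⟨0, 0, 1, 0, -1⟩ : WeierstrassCurve ℚ) (ringClassField K ι (9 * p * (ℓ * ℓ')))) σ' ℓ' yℓ'))))) ∈
      invPoints (absoluteGaloisGroup K)
        ((FixedPoints.addSubgroup N (geomPoints ((cubeSumCurve 9).baseChange K))).map ψA.toAddMonoidHom) ((2 : ℕ) : ℤ))
    -- the place, and the displayed inputs about `P_{ℓ'}` at `λ`
    (v : HeightOneSpectrum (𝓞 K)) (hv : (ℓ : 𝓞 K) ∈ v.asIdeal)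
    (hPmFrob : ∀ 𝔓 ∈ v.primesAbove, ∀ F : absoluteGaloisGroup K, IsArithFrobAt (𝓞 K) F 𝔓 →
      F • κ.symm (ιe (KolyvaginOperator.derivOp (pointGalHom (⟨0, 0, 1, 0, -1⟩ : WeierstrassCurve ℚ) (ringClassField K ι (9 * p * (ℓ * ℓ')))) σ' ℓ' yℓ')) = κ.symm (ιe (KolyvaginOperator.derivOp (pointGalHom (⟨0, 0, 1, 0, -1⟩ : WeierstrassCurve ℚ) (ringClassField K ι (9 * p * (ℓ * ℓ')))) σ' ℓ' yℓ')))
    (hsel₂ : kolyvaginClass ((cubeSumCurve (3 * (p : ℚ) ^ 2)).baseChange K) ((2 : ℕ) : ℤ) hdivA hA₂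
      (ψA (∑ i, ρ (t i) (ρ (t i) (t i • κ.symm (ιe (KolyvaginOperator.derivOp (pointGalHom (⟨0, 0, 1, 0, -1⟩ : WeierstrassCurve ℚ) (ringClassField K ι (9 * p * (ℓ * ℓ')))) σ' ℓ' yℓ')))))) hP₂ ∈
      selmerLocalKer ((cubeSumCurve (3 * (p : ℚ) ^ 2)).baseChange K) (v.adicCompletion K) ((2 : ℕ) : ℤ))
    -- (ES2), γ-wise, at the conductors `(9pℓℓ', 9pℓ')` — DISPLAYED (k-ty1 #20 on HSY's tower)
    (hES : ∀ (φ₀ : absoluteGaloisGroup (ZMod ℓ)), (∀ x : AlgebraicClosure (ZMod ℓ), φ₀ • x = x ^ ℓ) →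
      ∀ (g : absoluteGaloisGroup K) (γ : ringClassField K ι (9 * p * (ℓ * ℓ')) ≃ₐ[ℚ] ringClassField K ι (9 * p * (ℓ * ℓ'))),
        geomReduction hΔ ((RatClosure.pointsEquiv (K := K) (⟨0, 0, 1, 0, -1⟩ : WeierstrassCurve ℚ)).symm
            (g • ιe (pointGalHom (⟨0, 0, 1, 0, -1⟩ : WeierstrassCurve ℚ) (ringClassField K ι (9 * p * (ℓ * ℓ'))) γ y))) =
          φ₀ • geomReduction hΔ ((RatClosure.pointsEquiv (K := K) (⟨0, 0, 1, 0, -1⟩ : WeierstrassCurve ℚ)).symm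
            (g • ιe (pointGalHom (⟨0, 0, 1, 0, -1⟩ : WeierstrassCurve ℚ) (ringClassField K ι (9 * p * (ℓ * ℓ'))) γ yℓ')))) :
    kolyvaginClass ((cubeSumCurve (p : ℚ)).baseChange K) ((2 : ℕ) : ℤ) hdivB hA₁
        (ψB (∑ i, ρ (t i) (t i • κ.symm (ιe (KolyvaginOperator.derivOp (pointGalHom (⟨0, 0, 1, 0, -1⟩ : WeierstrassCurve ℚ) (ringClassField K ι (9 * p * (ℓ * ℓ')))) σ ℓ
          (KolyvaginOperator.derivOp (pointGalHom (⟨0, 0, 1, 0, -1⟩ : WeierstrassCurve ℚ) (ringClassField K ι (9 * p * (ℓ * ℓ')))) σ' ℓ' y)))))) hP₁ ∈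
        selmerLocalKer ((cubeSumCurve (p : ℚ)).baseChange K) (v.adicCompletion K) ((2 : ℕ) : ℤ) ↔
      kolyvaginClass ((cubeSumCurve (3 * (p : ℚ) ^ 2)).baseChange K) ((2 : ℕ) : ℤ) hdivA hA₂
          (ψA (∑ i, ρ (t i) (ρ (t i) (t i • κ.symm (ιe (KolyvaginOperator.derivOp (pointGalHom (⟨0, 0, 1, 0, -1⟩ : WeierstrassCurve ℚ) (ringClassField K ι (9 * p * (ℓ * ℓ')))) σ' ℓ' yℓ')))))) hP₂ ∈
        ((cubeSumCurve (3 * (p : ℚ) ^ 2)).baseChange K).torsionLocalKer (v.adicCompletion K) ((2 : ℕ) : ℤ) := by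
  -- ### basics
  have hℓ : ℓ.Prime := Fact.out
  have hK := JZero.isImaginaryQuadratic_of_sq_add_self_add_one hω h2
  have hdK := JZero.discr_eq_neg_three_of_sq_add_self_add_one hω h2
  have hinert := JZero.span_natCast_isPrime_of_mod_three_eq_two hω h2 hℓ hℓ3
  have hp0 : p ≠ 0 := hp.ne_zero
  have hp0' : (p : ℚ) ≠ 0 := by exact_mod_cast hp0
  have hp2 : p ≠ 2 := by rintro rfl; norm_num at hp3
  have hℓ3' : ℓ ≠ 3 := by rintro rfl; simp at hℓ3
  have hℓ9 : ¬ ℓ ∣ 9 := by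
    intro h
    have h' : ℓ ∣ 3 ^ 2 := by norm_num; exact h
    exact hℓ3' ((Nat.prime_dvd_prime_iff_eq hℓ Nat.prime_three).mp (hℓ.dvd_of_dvd_pow h'))
  have hℓ9p : ¬ ℓ ∣ 9 * p := by
    intro h
    rcases (Nat.Prime.dvd_mul hℓ).mp h with h9 | hp'
    · exact hℓ9 h9
    · exact hℓp hp'
  have hf : 9 * p ≠ 0 := mul_ne_zero (by norm_num) hp0
  have hfℓ' : 9 * p * ℓ' ≠ 0 := mul_ne_zero hf hℓ'.ne_zero
  have hℓℓ' : ¬ ℓ ∣ 9 * p * ℓ' := fun h ↦ by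
    rcases (Nat.Prime.dvd_mul hℓ).mp h with h1 | h2'
    · exact hℓ9p h1
    · exact hne ((Nat.prime_dvd_prime_iff_eq hℓ hℓ').mp h2')
  have hn0 : 9 * p * (ℓ * ℓ') ≠ 0 := mul_ne_zero hf (mul_ne_zero hℓ.ne_zero hℓ'.ne_zero)
  have hlevℓ : ℓ * (9 * p * ℓ') = 9 * p * (ℓ * ℓ') := by ring
  have hp_odd : Odd p := hp.eq_two_or_odd'.resolve_left hp2
  haveI := (finiteDimensional_and_isGalois_ringClassField hK ι hn0).1
  haveI := (finiteDimensional_and_isGalois_ringClassField hK ι hn0).2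
  haveI hBell : ((cubeSumCurve (p : ℚ)).baseChange K).IsElliptic := isElliptic_cubeSumCurve_baseChange K hp0'
  haveI hAell : ((cubeSumCurve (3 * (p : ℚ) ^ 2)).baseChange K).IsElliptic :=
    isElliptic_cubeSumCurve_baseChange K (by positivity)
  haveI hAellQ : (cubeSumCurve (3 * (p : ℚ) ^ 2)).IsElliptic := by
    have h := isElliptic_cubeSumCurve_baseChange ℚ (show (3 * (p : ℚ) ^ 2) ≠ 0 by positivity)
    rwa [WeierstrassCurve.baseChange, Algebra.algebraMap_self, WeierstrassCurve.map_id] at h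
  haveI hNn : N.Normal := normal_of_mem_iff emb hemb N hN
  have hNN' : N ≤ N' := le_of_mem_iff_of_mem_iff_forall emb hN hN'
  have hcomm := commutator_mem_of_ringClassField hK ι hn0 emb hemb N hN
  -- `N'` (hence `N`) fixes the cube roots `v_B`, `v_A`
  have hN'B := forall_apply_eq_of_pow_three_eq_div_nine_of_fix_nine_mul hω h2 ι hp0
    (mul_ne_zero hℓ.ne_zero hℓ'.ne_zero) emb hemb N' hN'
  have hN'A := forall_apply_eq_of_pow_three_eq_sq_div_three_of_fix_nine_mul hω h2 ι hp0
    (mul_ne_zero hℓ.ne_zero hℓ'.ne_zero) emb hemb N' hN'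
  have hN'vB : ∀ h ∈ N', (show AlgebraicClosure K ≃ₐ[K] AlgebraicClosure K from h) vB = vB :=
    fun h hh ↦ hN'B h hh vB hvBc
  have hN'vA : ∀ h ∈ N', (show AlgebraicClosure K ≃ₐ[K] AlgebraicClosure K from h) vA = vA :=
    fun h hh ↦ hN'A h hh vA hvAc
  have hNvB : ∀ h ∈ N, (show AlgebraicClosure K ≃ₐ[K] AlgebraicClosure K from h) vB = vB :=
    fun h hh ↦ hN'vB h (hNN' hh)
  -- the `ρ ∘ ρ` family (`W₂ = A_K`, `ρ' = ρ ∘ ρ`)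
  have hρρ' : ∀ (g : absoluteGaloisGroup K) {x y : AlgebraicClosure K}
      (h : (((cubeSumCurve 9).baseChange K).baseChange (AlgebraicClosure K)).toAffine.Nonsingular x y),
      ∃ h', (fun g ↦ (ρ g).trans (ρ g)) g (Affine.Point.some x y h) =
        Affine.Point.some (((show AlgebraicClosure K ≃ₐ[K] AlgebraicClosure K from g) vA / vA) ^ 2 * x)
          y h' := fun g x y h ↦ hρρ g h
  have hρ' : ∀ (g : absoluteGaloisGroup K) (x : geomPoints ((cubeSumCurve 9).baseChange K)),
      (fun g ↦ (ρ g).trans (ρ g)) g x = ρ g (ρ g x) := fun g x ↦ rfl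
  have hlawA' : ∀ (g : absoluteGaloisGroup K) (P : geomPoints ((cubeSumCurve 9).baseChange K)),
      g • ψA P = ψA ((fun g ↦ (ρ g).trans (ρ g)) g (g • P)) := fun g P ↦ hlawA g P
  -- ### the Kolyvagin-prime structure for `A`, the place, `𝔐`, the Frobenius
  have hKolA : IsKolyvaginPrime ((cubeSumCurve (3 * (p : ℚ) ^ 2)).conductorNorm ℤ)
      (cubeSumCurve (3 * (p : ℚ) ^ 2)) K 2 ℓ := ⟨hℓ, hℓA, hℓdK, hℓ2, hinert, hFrobA⟩
  have hvpl : v = hKolA.place := hKolA.mem_iff.mp hv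
  have huniq : ∀ w : HeightOneSpectrum (𝓞 K), (ℓ : 𝓞 K) ∈ w.asIdeal → w = v :=
    fun w hw ↦ (hKolA.mem_iff.mp hw).trans hvpl.symm
  have hres : v.residueCard = ℓ ^ 2 := by rw [hvpl]; exact KolyvaginH44.residueCard_place_eq_sq hK hKolA
  haveI : CharZero (v.adicCompletion K) :=
    charZero_of_injective_algebraMap (algebraMap K (v.adicCompletion K)).injective
  obtain ⟨𝔐, h𝔐⟩ := v.localPrimesAbove_nonempty
  have h𝔓 : v.primeBelow (closureEmb (K := K) (v.adicCompletion K)) 𝔐 ∈ v.primesAbove :=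
    HeightOneSpectrum.primeBelow_mem_primesAbove h𝔐
  have hℓM : FrobEqFrobInfty (cubeSumCurve (3 * (p : ℚ) ^ 2)) K (2 ^ 1) ℓ := by rw [pow_one]; exact hFrobA
  have h𝔔 : v.primeBelow (closureEmb (K := K) (v.adicCompletion K)) 𝔐 ∈ hKolA.place.primesAbove := by
    rw [← hvpl]; exact h𝔓
  obtain ⟨F, hF, hFfix⟩ := exists_isArithFrobAt_mem_torsionFixing (cubeSumCurve (3 * (p : ℚ) ^ 2)) hK hKolA hℓM h𝔔
  have hsurj := (torsionPointsMap_bijective ((cubeSumCurve (3 * (p : ℚ) ^ 2)).baseChange K) (v.adicCompletion K)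
    (show (2 ^ 1 : ℕ) ≠ 0 by norm_num)).2
  -- the place is good for `A_K`, `B_K` and prime to `2`
  have h3v : ((3 : ℕ) : 𝓞 K) ∉ v.asIdeal := not_natCast_mem_of_prime_ne hℓ Nat.prime_three hℓ3' v hv
  have hpv : ((p : ℕ) : 𝓞 K) ∉ v.asIdeal :=
    not_natCast_mem_of_prime_ne hℓ hp (fun h ↦ hℓp (h ▸ dvd_rfl)) v hv
  have h2v : ((2 : ℕ) : 𝓞 K) ∉ v.asIdeal := not_natCast_mem_of_prime_ne hℓ Nat.prime_two hℓ2 v hv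
  have hgoodA := hasGoodReductionAt_cubeSumCurve_three_mul_sq_baseChange (K := K) hp hp2 v h3v hpv
  have hgoodB := hasGoodReductionAt_cubeSumCurve_prime_baseChange (K := K) hp hp2 v h3v hpv
  -- ### the inertia package (level `ℓ · (9pℓ')`): `τ₀ ↦ σ_ℓ`, and `I_𝔓, F ∈ N'`
  obtain ⟨⟨τ₀, hτ₀, hτ₀σ, hI⟩, hIN'', hFN''⟩ := inertia_package_pair hK ι hfℓ' hℓ hℓℓ' hv hinert emb hemb h𝔓 hσ
    N hN N' hN' (geomPoints ((cubeSumCurve (p : ℚ)).baseChange K))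
  have hFmem : F ∈ N' := hFN'' F hF
  have hFvA : (show AlgebraicClosure K ≃ₐ[K] AlgebraicClosure K from F) vA = vA := hN'vA F hFmem
  have hIvB : ∀ τ ∈ (v.primeBelow (closureEmb (K := K) (v.adicCompletion K)) 𝔐).inertia
      (absoluteGaloisGroup K), (show AlgebraicClosure K ≃ₐ[K] AlgebraicClosure K from τ) vB = vB :=
    fun τ hτ ↦ hN'vB τ (hIN'' τ hτ)
  -- ### the reduction datum of the frame for `ρ` (`W₁ = B_K`)
  obtain ⟨φ₀, hφ₀'⟩ := exists_frobenius_absoluteGaloisGroup (ZMod ℓ)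
  have hφ₀ : ∀ x : AlgebraicClosure (ZMod ℓ), φ₀ • x = x ^ ℓ := fun x ↦ by rw [hφ₀' x, Nat.card_zmod]
  obtain ⟨-, l', hl'⟩ := IsKolyvaginPrime.pow_dvd_add_one (cubeSumCurve (3 * (p : ℚ) ^ 2)) Nat.prime_two hKolA
    (le_refl 1) hℓM
  obtain ⟨g₀, red, φ, ρt, hredg, hφ, hredρ, hφρ, hredI, hredF, hinj, hBn, hχ⟩ :=
    exists_frame_reductionDatum (K := K) hℓ3 hℓ2 hΔ hl' κ hκG hκ hvB hvB3 ρ hρ hv huniq hres h𝔓 hF hφ₀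
  -- ### the points `P_{ℓℓ'}`, `P_{ℓ'}`: `N`-fixed
  have hκs : ∀ (g : absoluteGaloisGroup K) (Q : geomPoints ((⟨0, 0, 1, 0, -1⟩ : WeierstrassCurve ℚ).baseChange K)),
      κ.symm (g • Q) = g • κ.symm Q := fun g Q ↦ by
    apply κ.injective
    rw [hκG, κ.apply_symm_apply, κ.apply_symm_apply]
  have hPnN' : ∀ h ∈ N, h • κ.symm (ιe (KolyvaginOperator.derivOp (pointGalHom (⟨0, 0, 1, 0, -1⟩ : WeierstrassCurve ℚ) (ringClassField K ι (9 * p * (ℓ * ℓ')))) σ ℓ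
          (KolyvaginOperator.derivOp (pointGalHom (⟨0, 0, 1, 0, -1⟩ : WeierstrassCurve ℚ) (ringClassField K ι (9 * p * (ℓ * ℓ')))) σ' ℓ' y))) = κ.symm (ιe (KolyvaginOperator.derivOp (pointGalHom (⟨0, 0, 1, 0, -1⟩ : WeierstrassCurve ℚ) (ringClassField K ι (9 * p * (ℓ * ℓ')))) σ ℓ
          (KolyvaginOperator.derivOp (pointGalHom (⟨0, 0, 1, 0, -1⟩ : WeierstrassCurve ℚ) (ringClassField K ι (9 * p * (ℓ * ℓ')))) σ' ℓ' y))) :=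
    (JZero.mem_fixedPoints_iff _ N _).mp (mem_fixedPoints_symm_of_equivariant κ hκG N
      (map_emb_mem_fixedPoints (⟨0, 0, 1, 0, -1⟩ : WeierstrassCurve ℚ) ι emb ιe hιe N hN _))
  have hPmN : ∀ h ∈ N, h • κ.symm (ιe (KolyvaginOperator.derivOp (pointGalHom (⟨0, 0, 1, 0, -1⟩ : WeierstrassCurve ℚ) (ringClassField K ι (9 * p * (ℓ * ℓ')))) σ' ℓ' yℓ')) = κ.symm (ιe (KolyvaginOperator.derivOp (pointGalHom (⟨0, 0, 1, 0, -1⟩ : WeierstrassCurve ℚ) (ringClassField K ι (9 * p * (ℓ * ℓ')))) σ' ℓ' yℓ')) :=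
    (JZero.mem_fixedPoints_iff _ N _).mp (mem_fixedPoints_symm_of_equivariant κ hκG N
      (map_emb_mem_fixedPoints (⟨0, 0, 1, 0, -1⟩ : WeierstrassCurve ℚ) ι emb ιe hιe N hN _))
  -- ### the inertia generator on `A₁ = ψ_B(E₉(K̄)^N)`
  have hIτ₀ : ∀ τ ∈ (v.primeBelow (closureEmb (K := K) (v.adicCompletion K)) 𝔐).inertia
      (absoluteGaloisGroup K), ∃ i : ℕ,
      ∀ x ∈ (FixedPoints.addSubgroup N (geomPoints ((cubeSumCurve 9).baseChange K))).map
        ψB.toAddMonoidHom, τ • x = (τ₀ ^ i) • x := by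
    intro τ hτ
    obtain ⟨i, -, hi⟩ := hI τ hτ
    refine ⟨i, fun x hx ↦ hi x ?_⟩
    obtain ⟨z, hz, rfl⟩ := hx
    exact (JZero.forall_smul_cubicTwist_eq_iff hψB (N := (N : Set (absoluteGaloisGroup K))) hNvB z).mpr
      ((JZero.mem_fixedPoints_iff _ N _).mp hz)
  -- ### THE ROOT `R = l' • κ⁻¹ ι(D_{ℓ'} y_{ℓℓ'})`: `σ_ℓ^i` commutes with `D_{ℓ'}`, and `Tr_ℓ y_{ℓℓ'} = a_ℓ y_{ℓ'} = 0`
  haveI : IsMulCommutative (ringClassGal ι (9 * p * (ℓ * ℓ'))) := KolyvaginH44.isMulCommutative_ringClassGal' hK ι _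
  have hσG : σ ∈ ringClassGal ι (9 * p * (ℓ * ℓ')) :=
    ringClassGalOver_le_ringClassGal ι _ _ (hσ ▸ Subgroup.mem_zpowers σ)
  have hσ'G : σ' ∈ ringClassGal ι (9 * p * (ℓ * ℓ')) :=
    ringClassGalOver_le_ringClassGal ι _ _ (hσ' ▸ Subgroup.mem_zpowers σ')
  have hcommσ : Commute σ σ' := by
    have h := (KolyvaginH44.isMulCommutative_ringClassGal' hK ι (9 * p * (ℓ * ℓ'))).is_comm.comm ⟨σ, hσG⟩ ⟨σ', hσ'G⟩
    exact congrArg Subtype.val h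
  have hunitsℓ' : 2 ≤ 9 * p * ℓ' ∨ NumberField.discr K < -4 := by
    left
    have h1 : 1 ≤ p * ℓ' := Nat.one_le_iff_ne_zero.mpr (mul_ne_zero hp0 hℓ'.ne_zero)
    have h2' : 9 * p * ℓ' = 9 * (p * ℓ') := by ring
    omega
  have hdivℓ : 9 * p * (ℓ * ℓ') / ℓ = 9 * p * ℓ' := by
    rw [show 9 * p * (ℓ * ℓ') = 9 * p * ℓ' * ℓ by ring, Nat.mul_div_cancel _ hℓ.pos]
  have hσd : Subgroup.zpowers σ = ringClassGalOver ι (9 * p * (ℓ * ℓ')) (9 * p * (ℓ * ℓ') / ℓ) := by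
    rw [hdivℓ]; exact hσ
  have hordσ : orderOf σ = ℓ + 1 :=
    orderOf_eq_succ_of_zpowers_eq_ringClassGalOver hK ι hℓ hinert ⟨9 * p * ℓ', by ring⟩
      (by rw [hdivℓ]; exact hℓℓ') hn0 (by rw [hdivℓ]; exact hunitsℓ') (by rw [hdivℓ]; exact hσ)
  have ha0 : (⟨0, 0, 1, 0, -1⟩ : WeierstrassCurve ℚ).LFunction ℓ = 0 :=
    JZero.lFunction_eq_zero_of_j_eq_zero_of_mod_three_eq_two _ j_sylvesterNineMinimal hℓ hℓ3 hℓ2 hΔ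
  have htrace : ∑ i ∈ Finset.range (ℓ + 1), pointGalHom (⟨0, 0, 1, 0, -1⟩ : WeierstrassCurve ℚ) (ringClassField K ι (9 * p * (ℓ * ℓ'))) (σ ^ i) y = 0 := by
    rw [sum_range_pow_eq_sum_image hK ι hlevℓ hℓ hinert hℓℓ' hfℓ' hunitsℓ' hσd
      (fun g ↦ pointGalHom (⟨0, 0, 1, 0, -1⟩ : WeierstrassCurve ℚ) (ringClassField K ι (9 * p * (ℓ * ℓ'))) g y),
      sum_pointGalHom_eq_lFunction_smul_sylvester_pair_left hK hdK ι Dt hp3 hℓ hℓ3 hℓ' hℓ'3 hne hℓp hinert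
        (fun g ↦ mem_image_pow_iff_mem_ringClassGalOver hK ι hlevℓ hℓ hinert hℓℓ' hfℓ' hunitsℓ' hσd g) hy hyℓ',
      ha0, zero_smul]
  have htr : ∑ i ∈ Finset.range (ℓ + 1), pointGalHom (⟨0, 0, 1, 0, -1⟩ : WeierstrassCurve ℚ) (ringClassField K ι (9 * p * (ℓ * ℓ'))) (σ ^ i) (KolyvaginOperator.derivOp (pointGalHom (⟨0, 0, 1, 0, -1⟩ : WeierstrassCurve ℚ) (ringClassField K ι (9 * p * (ℓ * ℓ')))) σ' ℓ' y) = 0 := by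
    have hc : ∀ i : ℕ, Commute (σ ^ i) σ' := fun i ↦ hcommσ.pow_left i
    simp_rw [pointGalHom_derivOp_comm (⟨0, 0, 1, 0, -1⟩ : WeierstrassCurve ℚ) (hc _) ℓ' y]
    unfold KolyvaginOperator.derivOp
    rw [Finset.sum_comm]
    refine Finset.sum_eq_zero fun k _ ↦ ?_
    rw [← Finset.smul_sum, ← map_sum, htrace, map_zero, smul_zero]
  have hDσ := pointGalHom_derivOp_sub_eq_of_trace_eq_zero (⟨0, 0, 1, 0, -1⟩ : WeierstrassCurve ℚ) (σ := σ) (ℓ := ℓ) (z := (KolyvaginOperator.derivOp (pointGalHom (⟨0, 0, 1, 0, -1⟩ : WeierstrassCurve ℚ) (ringClassField K ι (9 * p * (ℓ * ℓ')))) σ' ℓ' y))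
    (by rw [← hordσ, pow_orderOf_eq_one]) htr
  have hτ₀D : τ₀ • κ.symm (ιe (KolyvaginOperator.derivOp (pointGalHom (⟨0, 0, 1, 0, -1⟩ : WeierstrassCurve ℚ) (ringClassField K ι (9 * p * (ℓ * ℓ')))) σ ℓ
          (KolyvaginOperator.derivOp (pointGalHom (⟨0, 0, 1, 0, -1⟩ : WeierstrassCurve ℚ) (ringClassField K ι (9 * p * (ℓ * ℓ')))) σ' ℓ' y))) - κ.symm (ιe (KolyvaginOperator.derivOp (pointGalHom (⟨0, 0, 1, 0, -1⟩ : WeierstrassCurve ℚ) (ringClassField K ι (9 * p * (ℓ * ℓ')))) σ ℓ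
          (KolyvaginOperator.derivOp (pointGalHom (⟨0, 0, 1, 0, -1⟩ : WeierstrassCurve ℚ) (ringClassField K ι (9 * p * (ℓ * ℓ')))) σ' ℓ' y))) = ((ℓ + 1 : ℕ) : ℤ) • κ.symm (ιe (KolyvaginOperator.derivOp (pointGalHom (⟨0, 0, 1, 0, -1⟩ : WeierstrassCurve ℚ) (ringClassField K ι (9 * p * (ℓ * ℓ')))) σ' ℓ' y)) := by
    rw [← hκs, ← map_sub κ.symm, ← map_zsmul κ.symm]
    congr 1
    exact smul_embPoints_sub_eq_zsmul (⟨0, 0, 1, 0, -1⟩ : WeierstrassCurve ℚ) emb ιe hιe τ₀ σ hτ₀σ (by convert hDσ)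
  have hR : ((2 ^ 1 : ℕ) : ℤ) • (l' • κ.symm (ιe (KolyvaginOperator.derivOp (pointGalHom (⟨0, 0, 1, 0, -1⟩ : WeierstrassCurve ℚ) (ringClassField K ι (9 * p * (ℓ * ℓ')))) σ' ℓ' y))) = τ₀ • κ.symm (ιe (KolyvaginOperator.derivOp (pointGalHom (⟨0, 0, 1, 0, -1⟩ : WeierstrassCurve ℚ) (ringClassField K ι (9 * p * (ℓ * ℓ')))) σ ℓ
          (KolyvaginOperator.derivOp (pointGalHom (⟨0, 0, 1, 0, -1⟩ : WeierstrassCurve ℚ) (ringClassField K ι (9 * p * (ℓ * ℓ')))) σ' ℓ' y))) - κ.symm (ιe (KolyvaginOperator.derivOp (pointGalHom (⟨0, 0, 1, 0, -1⟩ : WeierstrassCurve ℚ) (ringClassField K ι (9 * p * (ℓ * ℓ')))) σ ℓ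
          (KolyvaginOperator.derivOp (pointGalHom (⟨0, 0, 1, 0, -1⟩ : WeierstrassCurve ℚ) (ringClassField K ι (9 * p * (ℓ * ℓ')))) σ' ℓ' y))) := by
    rw [hτ₀D, smul_smul, hl']
    norm_num
  have hRN : l' • κ.symm (ιe (KolyvaginOperator.derivOp (pointGalHom (⟨0, 0, 1, 0, -1⟩ : WeierstrassCurve ℚ) (ringClassField K ι (9 * p * (ℓ * ℓ')))) σ' ℓ' y)) ∈ FixedPoints.addSubgroup N (geomPoints ((cubeSumCurve 9).baseChange K)) :=
    AddSubgroup.zsmul_mem _ (mem_fixedPoints_symm_of_equivariant κ hκG N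
      (map_emb_mem_fixedPoints (⟨0, 0, 1, 0, -1⟩ : WeierstrassCurve ℚ) ι emb ιe hιe N hN _)) l'
  have hRA : ψB (∑ i, ρ (t i) (t i • (l' • κ.symm (ιe (KolyvaginOperator.derivOp (pointGalHom (⟨0, 0, 1, 0, -1⟩ : WeierstrassCurve ℚ) (ringClassField K ι (9 * p * (ℓ * ℓ')))) σ' ℓ' y))))) ∈
      (FixedPoints.addSubgroup N (geomPoints ((cubeSumCurve 9).baseChange K))).map ψB.toAddMonoidHom := by
    refine ⟨_, ?_, rfl⟩
    exact KolyvaginCocycle.chiComponent_mem (fun g ↦ (ρ g).toAddMonoidHom)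
      (fun g _ ha ↦ JZero.smul_mem_fixedPoints _ N g ha)
      (fun g _ ha ↦ JZero.rho_mem_fixedPoints _ hω hvB hvB3 hρ N g ha) t hRN
  -- the FLIPPED reduction of the root, from the γ-wise (ES2) pushed through `D_{ℓ'}`
  have hRred : ∀ i, red (t i • (l' • κ.symm (ιe (KolyvaginOperator.derivOp (pointGalHom (⟨0, 0, 1, 0, -1⟩ : WeierstrassCurve ℚ) (ringClassField K ι (9 * p * (ℓ * ℓ')))) σ' ℓ' y)))) = l' • φ (red (t i • κ.symm (ιe (KolyvaginOperator.derivOp (pointGalHom (⟨0, 0, 1, 0, -1⟩ : WeierstrassCurve ℚ) (ringClassField K ι (9 * p * (ℓ * ℓ')))) σ' ℓ' yℓ')))) := by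
    intro i
    have key := map_smul_derivOp_eq_of_forall (⟨0, 0, 1, 0, -1⟩ : WeierstrassCurve ℚ) ιe
      ((geomReduction hΔ).comp
        (RatClosure.pointsEquiv (K := K) (⟨0, 0, 1, 0, -1⟩ : WeierstrassCurve ℚ)).symm.toAddMonoidHom)
      (DistribSMul.toAddMonoidHom _ φ₀) (g₀⁻¹ * t i) σ' ℓ' (y := y) (y₀ := yℓ')
      (fun k ↦ hES φ₀ hφ₀ (g₀⁻¹ * t i) (σ' ^ k))
    simp only [AddMonoidHom.comp_apply, AddEquiv.coe_toAddMonoidHom, DistribSMul.toAddMonoidHom_apply] at key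
    rw [KolyvaginCocycle.smul_zsmul_comm, map_zsmul, hredg, hredg, ← hκs, ← hκs, κ.apply_symm_apply,
      κ.apply_symm_apply, ← mul_smul, ← mul_smul, hφ]
    congr 1
    convert key
  -- ### `F` fixes `P_{ℓ'}^{χ_A}` (displayed `hPmFrob`)
  have hFP₂ : F • ψA (∑ i, ρ (t i) (ρ (t i) (t i • κ.symm (ιe (KolyvaginOperator.derivOp (pointGalHom (⟨0, 0, 1, 0, -1⟩ : WeierstrassCurve ℚ) (ringClassField K ι (9 * p * (ℓ * ℓ')))) σ' ℓ' yℓ'))))) =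
      ψA (∑ i, ρ (t i) (ρ (t i) (t i • κ.symm (ιe (KolyvaginOperator.derivOp (pointGalHom (⟨0, 0, 1, 0, -1⟩ : WeierstrassCurve ℚ) (ringClassField K ι (9 * p * (ℓ * ℓ')))) σ' ℓ' yℓ'))))) := by
    have h1 : F • (∑ i, ρ (t i) (ρ (t i) (t i • κ.symm (ιe (KolyvaginOperator.derivOp (pointGalHom (⟨0, 0, 1, 0, -1⟩ : WeierstrassCurve ℚ) (ringClassField K ι (9 * p * (ℓ * ℓ')))) σ' ℓ' yℓ'))))) =
        ∑ i, ρ (t i) (ρ (t i) (t i • κ.symm (ιe (KolyvaginOperator.derivOp (pointGalHom (⟨0, 0, 1, 0, -1⟩ : WeierstrassCurve ℚ) (ringClassField K ι (9 * p * (ℓ * ℓ')))) σ' ℓ' yℓ')))) :=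
      JZero.smul_chiComponent_eq_self hω hvA0 hvA3 hρρ' N hcomm t hPmN (hPmFrob _ h𝔓 F hF)
    have h2' : ∀ Q : geomPoints ((cubeSumCurve 9).baseChange K), ρ F (ρ F Q) = Q :=
      fun Q ↦ JZero.rho_apply_of_apply_eq hvA0 hρρ' hFvA Q
    rw [hlawA, h1, h2']
  -- ### ONE CALL of k-ty1 #14
  have key := JZero.zsmul_kolyvaginClass_cubicTwist_mem_selmerLocalKer_iff_mem_torsionLocalKer
    (W := (cubeSumCurve 9).baseChange K) (W₁ := (cubeSumCurve (p : ℚ)).baseChange K)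
    (W₂ := (cubeSumCurve (3 * (p : ℚ) ^ 2)).baseChange K) Nat.prime_two (M := 1) hψB hψA
    ρ (fun g ↦ (ρ g).trans (ρ g)) hρ' hρcomm N hcomm t hPnN' (hdiv₁ := hdivB) (hdiv₂ := hdivA)
    hA₁ hA₂ hP₁ hP₂ hgoodB hgoodA h2v h𝔐 hF hFfix hsurj hFvA hIvB red φ ρt hredρ hφρ hredI hredF hinj
    hBn hχ hτ₀ hIτ₀ hR hRA hRred hFP₂ hsel₂ 1
  rw [one_zsmul, one_zsmul] at key
  exact key

end Summit.BirchSwinnertonDyer.BirchSwinnertonDyer.Theorems.SylvesterTwoCMFlip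

end
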